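import Literature.MathematicalPhysics.QuantumFieldTheory.Balaban1983to89.Node00.LinearisedAveragingCovariantLocal

/-!
# NODE 00 — GUARD-FREE GAUGE EQUIVARIANCE OF THE MATRIX EXTENSION OF THE AVERAGING AND OF `Q_k(U₀)` AS AN OPERATOR; THE MULTI-LEVEL (0.4) WINDOW OF `Q_k`
# (module D4-cov′∕loc′ of the [15] Sect. B audit of seat `pub-ymgap-dag-n07-w1`; g0's successor trigger (t2))

Cell `pub-ymgap`, width seat `pub-ymgap-dag-n07-w1` generation 4 (DAG node N07 = [15] = [Balaban1985Variational]; CLAIM-1 INBOX l.28558 ∕ re-affirmed l.28900).  NEW leaf,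
`--kind definition --supports stmt-QuantumFields-20542` (K1⁷), count-neutral.  CONSUMED BY NAME, nothing modified: 35b `Node00.AveragingSmooth` (`coeField`, `stepM`, `holM`, `loopM`,
`axialM`, `corrM`, `avgM`, `iterM`, `SmallBelow`), this seat's `Node00.LinearisedAveragingAtBackground` (`dIterL` = `Q_k`, `qLin`, `dAvgL`, `dIterL_succ`, `loopM_iterM_mem_polydisc`) and
`Node00.LinearisedAveragingCovariantLocal` (`dAvgL_apply_congr_of_window`), `Node00.WilsonActionSecondVariation` (`star_coe_mul_coe_SU`, `coe_mul_star_coe_SU`, `star_coe_mul_coe_mul_SU`,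
`coe_inv_SU`), the tree's `T4Continuum.walk ∕ walkEnd` + `Site.shift_unshift`, `BlockAveraging.netDisp_loopWord ∕ walkEnd_eq_self_of_netDisp` (the (0.4) loop words are closed) and
`BlockAveraging.walkEnd_replicate_L` (the straight segment from `emb c₋` ends at `emb c₊` — NO standing-range hypothesis), `ExpMeanLog.eml_conj` ((0.6) for the printed `exp[mean log]`,
unconditional), `B16Sect1Backgrounds.toMS ∕ invG` (restriction of a gauge transformation up the levels; pointwise inverse), `T4AdjointCovarianceUnitary.specialUnitaryAd`, Mathlib
`ContinuousLinearEquiv.equivOfInverse ∕ comp_right_fderiv ∕ comp_fderiv ∕ comp_right_differentiableAt_iff ∕ comp_differentiableAt_iff`.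

THE PRINT.  [Balaban1985Averaging] (8) p. 18 (`U^u(x,x′) = u(x)U(x,x′)u⁻¹(x′)`), (11) p. 19 (`Ū^u = (Ū)^ū`); [Balaban1987RG1] (0.4), (0.6) p. 253 (the averaging of record and the
two-sided equivariance `exp[mean log]{vW_iw} = v·exp[mean log]{W_i}·w` of its correction factor); [Balaban1985Variational] (44) p. 285 with (153) p. 301 (`Q_k(U₀)` and the covariance of the
operators of Sects. B–C under gauge transformations of the background); [Balaban1985BackgroundPropagators] (3.29) p. 395 (`R(u)` on Lie-algebra fields).

WHY THIS FILE (g0's HANDOFF «Untried», dag-n07-e's BRIDGE-92 (4)–(5)).  g0's `qLin_gaugeAct` differentiates the TRUE averaging along `SU(N)` data and therefore carries 35b's guard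
`SmallBelow` and the standing range `k ≤ m + K`; the gauge-SHEARED averages of the Sect. F data side (BRIDGE-92) conjugate the iterate by site unitaries that are NOT small and want the
covariance of `Q_k(V₀)` as an identity of OPERATORS on ALL matrix-valued fine fields.  On 35b's matrix extension this is pure algebra: walk products telescope (§2), the loop words are
closed and the segment ends at the next block centre, the unguarded `exp[mean log]` is conjugation-equivariant — so `iterM k (C_u V) = C_{u↾k}(iterM k V)` for EVERY matrix field `V`,
with NO guard and NO range hypothesis (§3), and differentiating through the continuous linear equivalence `C_u` transports `fderiv` (including its junk value off the differentiability
locus) consistently: `Q_k(C_u V₀) ∘ C_u = C_{u↾k} ∘ Q_k(V₀)` (§4).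

CONTENTS (`M = M_N(ℂ)`; `u : GaugeTransf P j (SU N)`; `C_u` = `fieldConj u`; `u↾k = toMS u k`).
* §1 `fieldConj u V b = u(b₋)·V(b)·u(b₊)⋆` (the conjugation of a MATRIX field by an `SU(N)` gauge transformation; on `SU(N)` data it is `GaugeField.gaugeAct`: `coeField_gaugeAct`; the
  tree's `B15ExtensionHolomorphic.gaugeActC` is the matrix-valued-`u`∕adjugate variant for holomorphy in `u`, not used here), linearity, `fieldConj_invG_left ∕ right`, ★ `fieldConjL u` —
  the same map as a CONTINUOUS LINEAR EQUIVALENCE of the matrix-field space (inverse `C_{u⁻¹}`), `fieldConjL_apply`, `fieldConjL_symm_apply`.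
* §2 `holM_fieldConj_walk` (`holM (C_u V) (walk x w) = u(x)·holM V (walk x w)·u(end)⋆` — the matrix twin of `T4Continuum.holAt_gaugeAct_walk`, for ALL matrix fields).
* §3 `loopM_fieldConj`, `axialM_fieldConj`, `corrM_fieldConj`, ★ `avgM_fieldConj` (`avgM (C_u V) = C_{u∘emb}(avgM V)`), ★★ `iterM_fieldConj` (`iterM k (C_u V) = C_{u↾k}(iterM k V)`) — no
  guard, no range hypothesis, every matrix field.
* §4 ★★ `fderiv_iterM_fieldConj_comp` ∕ `dIterL_fieldConj_comp` (`Q_k(C_u V₀) ∘ C_u = C_{u↾k} ∘ Q_k(V₀)` as continuous linear maps, EVERY `V₀`), `dIterL_fieldConj_apply`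
  (`Q_k(C_u V₀)(C_u Y) = C_{u↾k}(Q_k(V₀) Y)`), `dIterL_fieldConj` (operator form with `C_{u⁻¹}` on the right), `differentiableAt_iterM_fieldConj_iff`.
* §5 ★★★ `qLin_gaugeAct_of_all` — **`(qLin k U^u (Ad_{u∘tgt} X))(c) = ū(c₊)·(qLin k U X)(c)·ū(c₊)⋆` for EVERY `U`, `X`, `k`, `c`: g0's `qLin_gaugeAct` WITHOUT `SmallBelow` and without
  `k ≤ m + K`** (`velField_gaugeAct`: the chart velocity field transforms by `C_u`).  No `avOfRecord` twin is needed: the statement does not mention the averaging family (it is about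
  35b's extension, which IS the record's averaging on the guard by `coeField_iter_eq_iterM`).
* §6 THE MULTI-LEVEL WINDOW (pointer (v) made multi-level): ★★ `dIterL_apply_congr_of_closedBelow` — under the guard below `k ≤ m + K`, for a bond family `S = (S_i)` closed downward under
  the (0.4) window (n07-w2's binder shape `hS`), two direction fields agreeing on `S_0` have the same `Q_k(↑U)`-images on `S_k` (induction on `dIterL_succ` with the one-step window
  `dAvgL_apply_congr_of_window`); `qLin_congr_of_closedBelow` (the same for print's left-trivialised reading); at NODE 00's objects `dIterL_apply_congr_of_closedBelow_avOfRecord`.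

HONEST FRAMING: algebra∕calculus bookkeeping about the tree's own averaging map (35b's matrix extension); the only new objects are the conjugation operator and its packaging as a
continuous linear equivalence; NO estimate of [15]∕[5]∕[7]; the BRIDGE-92 (88)-functional and the (154)–(156) data side are NOT touched; N07 NOT discharged; counts unmoved (typed 28∕28 ·
discharged 5∕27); one finite 𝕋⁴ programme at fixed ε — NOT continuum ∕ ℝ⁴ ∕ OS ∕ mass gap ∕ Clay (R4 closes the conditional finite-𝕋⁴ rung `BalabanLadder.UV` only).  No `sorry`, no
`instance`, no `notation`.
-/

noncomputable section

namespace Literature.MathematicalPhysics.QuantumFieldTheory.Balaban1983to89.Node00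

open Filter Topology
open T4Continuum BlockAveraging B15DeterminingSets
open ExpMeanLog (eml eml_conj expMeanLogSU)
open T4AdjointCovarianceUnitary (lieSU specialUnitaryAd coe_specialUnitaryAd)
open B16Sect1Backgrounds (toMS invG)
open scoped Matrix.Norms.L2Operator

/-! ## §1  The conjugation operator `C_u` on matrix-valued bond fields -/

section Conj

variable {P : Params} {j : ℕ} {N : ℕ}

/-- **THE CONJUGATION OF A MATRIX-VALUED BOND FIELD BY AN `SU(N)` GAUGE TRANSFORMATION**: `(C_u V)(b) = u(b₋)·V(b)·u(b₊)⋆` — the formula (8) `U^u(x,x′) = u(x)U(x,x′)u⁻¹(x′)` read on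
matrix-valued fields (`u⁻¹ = u⋆` in `SU(N)`); on `SU(N)` data it is the tree's `GaugeField.gaugeAct` (`coeField_gaugeAct`). [cite: Balaban1985Averaging, (8) p.18] -/
def fieldConj (u : GaugeTransf P j (SU N)) (V : PBond P j → Matrix (Fin N) (Fin N) ℂ) : PBond P j → Matrix (Fin N) (Fin N) ℂ :=
  fun b => (u b.src : Matrix (Fin N) (Fin N) ℂ) * V b * star (u b.tgt : Matrix (Fin N) (Fin N) ℂ)

/-- Unfolding of `fieldConj`. [cite: Balaban1985Averaging, (8) p.18 (bookkeeping)] -/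
@[simp] theorem fieldConj_apply (u : GaugeTransf P j (SU N)) (V : PBond P j → Matrix (Fin N) (Fin N) ℂ) (b : PBond P j) :
    fieldConj u V b = (u b.src : Matrix (Fin N) (Fin N) ℂ) * V b * star (u b.tgt : Matrix (Fin N) (Fin N) ℂ) := rfl

/-- `C_u` is additive. [cite: Balaban1985Averaging, (8) p.18 (bookkeeping)] -/
theorem fieldConj_add (u : GaugeTransf P j (SU N)) (V W : PBond P j → Matrix (Fin N) (Fin N) ℂ) :
    fieldConj u (V + W) = fieldConj u V + fieldConj u W := by
  funext b
  simp only [fieldConj_apply, Pi.add_apply, mul_add, add_mul]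

/-- `C_u` is real-homogeneous. [cite: Balaban1985Averaging, (8) p.18 (bookkeeping)] -/
theorem fieldConj_smul (u : GaugeTransf P j (SU N)) (a : ℝ) (V : PBond P j → Matrix (Fin N) (Fin N) ℂ) :
    fieldConj u (a • V) = a • fieldConj u V := by
  funext b
  simp only [fieldConj_apply, Pi.smul_apply, mul_smul_comm, smul_mul_assoc]

/-- `C_u 0 = 0`. [cite: Balaban1985Averaging, (8) p.18 (bookkeeping)] -/
@[simp] theorem fieldConj_zero (u : GaugeTransf P j (SU N)) : fieldConj u (0 : PBond P j → Matrix (Fin N) (Fin N) ℂ) = 0 := by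
  funext b
  simp only [fieldConj_apply, Pi.zero_apply, mul_zero, zero_mul]

/-- The bond-wise conjugation written with the tree's continuous-linear-map letters (`proj`, `smulRight`, left multiplication), applied. [cite: Balaban1985Averaging, (8) p.18 (bookkeeping)] -/
theorem pi_conj_apply (u : GaugeTransf P j (SU N)) (V : PBond P j → Matrix (Fin N) (Fin N) ℂ) :
    (ContinuousLinearMap.pi fun b : PBond P j =>
        (u b.src : Matrix (Fin N) (Fin N) ℂ) •
          ((ContinuousLinearMap.proj (R := ℝ) (φ := fun _ : PBond P j => Matrix (Fin N) (Fin N) ℂ) b).smulRight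
            (star (u b.tgt : Matrix (Fin N) (Fin N) ℂ)))) V = fieldConj u V := by
  funext b
  simp only [ContinuousLinearMap.pi_apply, smul_apply, ContinuousLinearMap.smulRight_apply,
    ContinuousLinearMap.proj_apply, smul_eq_mul, fieldConj_apply, mul_assoc]

variable [NeZero N]

/-- ★ **ON `SU(N)` DATA THE CONJUGATION IS THE GAUGE ACTION**: `↑(U^u) = C_u ↑U`. [cite: Balaban1985Averaging, (8) p.18] -/
theorem coeField_gaugeAct (u : GaugeTransf P j (SU N)) (U : GaugeField P j (SU N)) :
    coeField (GaugeField.gaugeAct u U) = fieldConj u (coeField U) := by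
  funext b
  show ((u b.src * U b * (u b.tgt)⁻¹ : SU N) : Matrix (Fin N) (Fin N) ℂ) = _
  rw [Submonoid.coe_mul, Submonoid.coe_mul]
  rfl

/-- `C_u` is multiplicative bond-wise up to the inner unitary: `C_u(V·W) (b) = (u(b₋)·V(b)·u(b₊)⋆)·(u(b₊)·W(b)·u(b₊)⋆)` is NOT `C_uV · C_uW`; what IS true and used: `C_u V b · C_u′ W b = u(b₋)·V(b)·W(b)·u′(b₊)⋆`
whenever `u(b₊) = u′(b₋)`-type cancellations occur — recorded in the walk lemma `holM_fieldConj_walk` below.  Here: the composition law `C_{u⁻¹}(C_u V) = V`. [cite: Balaban1985Averaging, (8) p.18] -/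
theorem fieldConj_invG_left (u : GaugeTransf P j (SU N)) (V : PBond P j → Matrix (Fin N) (Fin N) ℂ) : fieldConj (invG u) (fieldConj u V) = V := by
  funext b
  simp only [fieldConj_apply, invG, coe_inv_SU, star_star]
  calc star (u b.src : Matrix (Fin N) (Fin N) ℂ) * ((u b.src : Matrix (Fin N) (Fin N) ℂ) * V b * star (u b.tgt : Matrix (Fin N) (Fin N) ℂ)) * (u b.tgt : Matrix (Fin N) (Fin N) ℂ)
        = (star (u b.src : Matrix (Fin N) (Fin N) ℂ) * (u b.src : Matrix (Fin N) (Fin N) ℂ)) * V b *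
            (star (u b.tgt : Matrix (Fin N) (Fin N) ℂ) * (u b.tgt : Matrix (Fin N) (Fin N) ℂ)) := by noncomm_ring
    _ = V b := by rw [star_coe_mul_coe_SU, star_coe_mul_coe_SU, one_mul, mul_one]

/-- The composition law `C_u(C_{u⁻¹} V) = V`. [cite: Balaban1985Averaging, (8) p.18] -/
theorem fieldConj_invG_right (u : GaugeTransf P j (SU N)) (V : PBond P j → Matrix (Fin N) (Fin N) ℂ) : fieldConj u (fieldConj (invG u) V) = V := by
  funext b
  simp only [fieldConj_apply, invG, coe_inv_SU, star_star]
  calc (u b.src : Matrix (Fin N) (Fin N) ℂ) * (star (u b.src : Matrix (Fin N) (Fin N) ℂ) * V b * (u b.tgt : Matrix (Fin N) (Fin N) ℂ)) * star (u b.tgt : Matrix (Fin N) (Fin N) ℂ)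
        = ((u b.src : Matrix (Fin N) (Fin N) ℂ) * star (u b.src : Matrix (Fin N) (Fin N) ℂ)) * V b *
            ((u b.tgt : Matrix (Fin N) (Fin N) ℂ) * star (u b.tgt : Matrix (Fin N) (Fin N) ℂ)) := by noncomm_ring
    _ = V b := by rw [coe_mul_star_coe_SU, coe_mul_star_coe_SU, one_mul, mul_one]

/-- ★ **THE CONJUGATION AS A CONTINUOUS LINEAR EQUIVALENCE OF THE MATRIX-FIELD SPACE** (inverse `C_{u⁻¹}`) — the letter through which `fderiv` is transported in §4.
[cite: Balaban1985Averaging, (8) p.18; Balaban1985Variational, (153) p.301] -/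
def fieldConjL (u : GaugeTransf P j (SU N)) :
    (PBond P j → Matrix (Fin N) (Fin N) ℂ) ≃L[ℝ] (PBond P j → Matrix (Fin N) (Fin N) ℂ) :=
  ContinuousLinearEquiv.equivOfInverse
    (ContinuousLinearMap.pi fun b : PBond P j =>
      (u b.src : Matrix (Fin N) (Fin N) ℂ) •
        ((ContinuousLinearMap.proj (R := ℝ) (φ := fun _ : PBond P j => Matrix (Fin N) (Fin N) ℂ) b).smulRight
          (star (u b.tgt : Matrix (Fin N) (Fin N) ℂ))))
    (ContinuousLinearMap.pi fun b : PBond P j =>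
      ((invG u b.src : SU N) : Matrix (Fin N) (Fin N) ℂ) •
        ((ContinuousLinearMap.proj (R := ℝ) (φ := fun _ : PBond P j => Matrix (Fin N) (Fin N) ℂ) b).smulRight
          (star ((invG u b.tgt : SU N) : Matrix (Fin N) (Fin N) ℂ))))
    (fun V => by rw [pi_conj_apply, pi_conj_apply, fieldConj_invG_left])
    (fun V => by rw [pi_conj_apply, pi_conj_apply, fieldConj_invG_right])

/-- `fieldConjL u V = C_u V`. [cite: Balaban1985Averaging, (8) p.18 (bookkeeping)] -/
@[simp] theorem fieldConjL_apply (u : GaugeTransf P j (SU N)) (V : PBond P j → Matrix (Fin N) (Fin N) ℂ) : fieldConjL u V = fieldConj u V := by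
  rw [fieldConjL, ContinuousLinearEquiv.equivOfInverse_apply]
  exact pi_conj_apply u V

/-- The underlying function of `fieldConjL u` is `C_u`. [cite: Balaban1985Averaging, (8) p.18 (bookkeeping)] -/
theorem coe_fieldConjL (u : GaugeTransf P j (SU N)) : ⇑(fieldConjL (N := N) u) = fieldConj u := funext (fieldConjL_apply u)

/-- `(fieldConjL u)⁻¹ V = C_{u⁻¹} V`. [cite: Balaban1985Averaging, (8) p.18 (bookkeeping)] -/
@[simp] theorem fieldConjL_symm_apply (u : GaugeTransf P j (SU N)) (V : PBond P j → Matrix (Fin N) (Fin N) ℂ) :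
    (fieldConjL u).symm V = fieldConj (invG u) V := by
  rw [fieldConjL, ContinuousLinearEquiv.symm_equivOfInverse, ContinuousLinearEquiv.equivOfInverse_apply]
  exact pi_conj_apply (invG u) V

end Conj

/-! ## §2  Walk products telescope under conjugation (every matrix field) -/

section Walks

variable {P : Params} {j : ℕ} {N : ℕ}

/-- ★ **THE MATRIX TWIN OF `holAt_gaugeAct_walk`**: for EVERY matrix field `V`, `holM (C_u V) (walk x w) = u(x)·holM V (walk x w)·u(end)⋆` — (8) telescoped along the walk, forward steps
contributing `u(y)V(b)u(y+e_μ)⋆`, backward steps `u(y)V(b)⋆u(y−e_μ)⋆`, the inner factors cancelling by `u⋆u = 1`. [cite: Balaban1985Averaging, (8) p.18] -/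
theorem holM_fieldConj_walk (u : GaugeTransf P j (SU N)) (V : PBond P j → Matrix (Fin N) (Fin N) ℂ) :
    ∀ (x : Site P j) (w : List (Letter P.d)),
      holM (fieldConj u V) (walk x w) = (u x : Matrix (Fin N) (Fin N) ℂ) * holM V (walk x w) * star (u (walkEnd x w) : Matrix (Fin N) (Fin N) ℂ)
  | x, [] => by simp [walk, walkEnd, holM_nil, coe_mul_star_coe_SU]
  | x, (μ, true) :: w => by
    rw [walk, walkEnd, holM_cons, holM_cons, holM_fieldConj_walk u V (x.shift μ) w]
    simp only [stepM, if_true, fieldConj_apply, PBond.tgt]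
    calc (u x : Matrix (Fin N) (Fin N) ℂ) * V ⟨x, μ⟩ * star (u (x.shift μ) : Matrix (Fin N) (Fin N) ℂ) *
          ((u (x.shift μ) : Matrix (Fin N) (Fin N) ℂ) * holM V (walk (x.shift μ) w) * star (u (walkEnd (x.shift μ) w) : Matrix (Fin N) (Fin N) ℂ))
        = (u x : Matrix (Fin N) (Fin N) ℂ) * (V ⟨x, μ⟩ * (star (u (x.shift μ) : Matrix (Fin N) (Fin N) ℂ) * ((u (x.shift μ) : Matrix (Fin N) (Fin N) ℂ) *
            holM V (walk (x.shift μ) w)))) * star (u (walkEnd (x.shift μ) w) : Matrix (Fin N) (Fin N) ℂ) := by noncomm_ring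
      _ = _ := by rw [star_coe_mul_coe_mul_SU]
  | x, (μ, false) :: w => by
    have hus : (x.unshift μ).shift μ = x := Site.shift_unshift x μ
    rw [walk, walkEnd, holM_cons, holM_cons, holM_fieldConj_walk u V (x.unshift μ) w]
    simp only [stepM, Bool.false_eq_true, if_false, fieldConj_apply, PBond.tgt, hus, star_mul, star_star]
    calc (u x : Matrix (Fin N) (Fin N) ℂ) * (star (V ⟨x.unshift μ, μ⟩) * star (u (x.unshift μ) : Matrix (Fin N) (Fin N) ℂ)) *
          ((u (x.unshift μ) : Matrix (Fin N) (Fin N) ℂ) * holM V (walk (x.unshift μ) w) * star (u (walkEnd (x.unshift μ) w) : Matrix (Fin N) (Fin N) ℂ))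
        = (u x : Matrix (Fin N) (Fin N) ℂ) * (star (V ⟨x.unshift μ, μ⟩) * (star (u (x.unshift μ) : Matrix (Fin N) (Fin N) ℂ) * ((u (x.unshift μ) : Matrix (Fin N) (Fin N) ℂ) *
            holM V (walk (x.unshift μ) w)))) * star (u (walkEnd (x.unshift μ) w) : Matrix (Fin N) (Fin N) ℂ) := by noncomm_ring
      _ = _ := by rw [star_coe_mul_coe_mul_SU]

end Walks

/-! ## §3  The one-step extension and the iterate are conjugation-equivariant — no guard, no range hypothesis -/

section OneStep

variable {P : Params} {j : ℕ} {N : ℕ}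

/-- The (0.4) loop matrices transform by conjugation with `u(emb c₋)` (closed words: `netDisp_loopWord`). [cite: Balaban1987RG1, (0.4) p.253; Balaban1985Averaging, (8) p.18] -/
theorem loopM_fieldConj (u : GaugeTransf P j (SU N)) (V : PBond P j → Matrix (Fin N) (Fin N) ℂ) (c : PBond P (j + 1)) (i : Idx P) :
    loopM (fieldConj u V) c i = (u (emb c.src) : Matrix (Fin N) (Fin N) ℂ) * loopM V c i * star (u (emb c.src) : Matrix (Fin N) (Fin N) ℂ) := by
  unfold loopM
  rw [holM_fieldConj_walk, walkEnd_eq_self_of_netDisp]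
  intro ν
  rw [netDisp_loopWord, Int.cast_zero]

/-- The straight-segment matrix transforms by `u(emb c₋)·(·)·u(emb c₊)⋆` (`walkEnd_replicate_L`: the segment ends at the next block centre — no range hypothesis).
[cite: Balaban1987RG1, (0.4) p.253; Balaban1985Averaging, (8) p.18] -/
theorem axialM_fieldConj (u : GaugeTransf P j (SU N)) (V : PBond P j → Matrix (Fin N) (Fin N) ℂ) (c : PBond P (j + 1)) :
    axialM (fieldConj u V) c = (u (emb c.src) : Matrix (Fin N) (Fin N) ℂ) * axialM V c * star (u (emb c.tgt) : Matrix (Fin N) (Fin N) ℂ) := by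
  unfold axialM
  rw [holM_fieldConj_walk, walkEnd_replicate_L]
  rfl

/-- The UNGUARDED correction factor transforms by conjugation with `u(emb c₋)` — (0.6) for the printed `exp[mean log]` (`ExpMeanLog.eml_conj`, unconditional).
[cite: Balaban1987RG1, (0.6) p.253] -/
theorem corrM_fieldConj (u : GaugeTransf P j (SU N)) (V : PBond P j → Matrix (Fin N) (Fin N) ℂ) (c : PBond P (j + 1)) :
    corrM (fieldConj u V) c = (u (emb c.src) : Matrix (Fin N) (Fin N) ℂ) * corrM V c * star (u (emb c.src) : Matrix (Fin N) (Fin N) ℂ) := by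
  unfold corrM
  rw [funext fun i => loopM_fieldConj u V c i]
  exact eml_conj (coe_mul_star_coe_SU _) (star_coe_mul_coe_SU _) _

/-- ★ **THE ONE-STEP MATRIX EXTENSION IS CONJUGATION-EQUIVARIANT FOR EVERY MATRIX FIELD**: `avgM (C_u V) = C_{u∘emb}(avgM V)` — (11) `Ū^u = (Ū)^ū` for 35b's extension, with NO small-field
guard and NO standing-range hypothesis. [cite: Balaban1985Averaging, (11) p.19; Balaban1987RG1, (0.4), (0.6) p.253] -/
theorem avgM_fieldConj (u : GaugeTransf P j (SU N)) (V : PBond P j → Matrix (Fin N) (Fin N) ℂ) :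
    avgM (fieldConj u V) = fieldConj (fun y => u (emb y)) (avgM V) := by
  funext c
  show corrM (fieldConj u V) c * axialM (fieldConj u V) c = _
  rw [corrM_fieldConj, axialM_fieldConj, fieldConj_apply]
  show _ = (u (emb c.src) : Matrix (Fin N) (Fin N) ℂ) * (corrM V c * axialM V c) * star (u (emb c.tgt) : Matrix (Fin N) (Fin N) ℂ)
  calc (u (emb c.src) : Matrix (Fin N) (Fin N) ℂ) * corrM V c * star (u (emb c.src) : Matrix (Fin N) (Fin N) ℂ) *
        ((u (emb c.src) : Matrix (Fin N) (Fin N) ℂ) * axialM V c * star (u (emb c.tgt) : Matrix (Fin N) (Fin N) ℂ))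
      = (u (emb c.src) : Matrix (Fin N) (Fin N) ℂ) * (corrM V c * (star (u (emb c.src) : Matrix (Fin N) (Fin N) ℂ) * ((u (emb c.src) : Matrix (Fin N) (Fin N) ℂ) *
          axialM V c))) * star (u (emb c.tgt) : Matrix (Fin N) (Fin N) ℂ) := by noncomm_ring
    _ = _ := by rw [star_coe_mul_coe_mul_SU]

end OneStep

section Iterate

variable {P : Params} {N : ℕ}

/-- ★★ **THE ITERATED MATRIX EXTENSION IS CONJUGATION-EQUIVARIANT FOR EVERY MATRIX FIELD, EVERY `k`**: `iterM k (C_u V) = C_{u↾k}(iterM k V)` — no guard, no range hypothesis (induction on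
`avgM_fieldConj`).  On `SU(N)` data inside the guard this is the tree's `iter_gaugeAct` read through `coeField_iter_eq_iterM`. [cite: Balaban1985Averaging, (11) p.19; Balaban1987RG1, (0.21) p.256] -/
theorem iterM_fieldConj (u : GaugeTransf P 0 (SU N)) :
    ∀ (k : ℕ) (V : PBond P 0 → Matrix (Fin N) (Fin N) ℂ), iterM k (fieldConj u V) = fieldConj (toMS u k) (iterM k V)
  | 0, _ => rfl
  | k + 1, V => by
    rw [iterM_succ, iterM_succ, iterM_fieldConj u k V, avgM_fieldConj]
    rfl

variable [NeZero N]

/-- The same as an identity of maps: `iterM k ∘ C_u = C_{u↾k} ∘ iterM k`. [cite: Balaban1985Averaging, (11) p.19; Balaban1987RG1, (0.21) p.256] -/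
theorem iterM_comp_fieldConjL (u : GaugeTransf P 0 (SU N)) (k : ℕ) :
    (iterM k : (PBond P 0 → Matrix (Fin N) (Fin N) ℂ) → PBond P k → Matrix (Fin N) (Fin N) ℂ) ∘ (fieldConjL u) =
      (fieldConjL (toMS u k)) ∘ (iterM k : (PBond P 0 → Matrix (Fin N) (Fin N) ℂ) → PBond P k → Matrix (Fin N) (Fin N) ℂ) := by
  funext V
  simp only [Function.comp_apply, fieldConjL_apply, iterM_fieldConj]

end Iterate

/-! ## §4  `Q_k(C_u V₀) ∘ C_u = C_{u↾k} ∘ Q_k(V₀)` — the derivative transported through the continuous linear equivalence, at EVERY field -/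

section Derivative

variable {P : Params} {N : ℕ} [NeZero N]

/-- ★★ **GUARD-FREE COVARIANCE OF THE LINEARISED `k`-FOLD AVERAGING AS AN OPERATOR**: for EVERY matrix field `V₀` (no guard, no range hypothesis, no differentiability hypothesis —
`fderiv`'s junk value is transported consistently through the equivalence), `Q_k(C_u V₀) ∘ C_u = C_{u↾k} ∘ Q_k(V₀)`. [cite: Balaban1985Variational, (44) p.285, (153) p.301; Balaban1985Averaging, (11) p.19] -/
theorem dIterL_fieldConj_comp (k : ℕ) (u : GaugeTransf P 0 (SU N)) (V₀ : PBond P 0 → Matrix (Fin N) (Fin N) ℂ) :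
    (dIterL k (fieldConj u V₀)).comp (fieldConjL u : (PBond P 0 → Matrix (Fin N) (Fin N) ℂ) →L[ℝ] (PBond P 0 → Matrix (Fin N) (Fin N) ℂ)) =
      (fieldConjL (toMS u k) : (PBond P k → Matrix (Fin N) (Fin N) ℂ) →L[ℝ] (PBond P k → Matrix (Fin N) (Fin N) ℂ)).comp (dIterL k V₀) := by
  unfold dIterL
  rw [← fieldConjL_apply, ← ContinuousLinearEquiv.comp_right_fderiv, iterM_comp_fieldConjL, ContinuousLinearEquiv.comp_fderiv]

/-- The same, applied: `Q_k(C_u V₀)(C_u Y) = C_{u↾k}(Q_k(V₀) Y)` for every `V₀`, `Y`. [cite: Balaban1985Variational, (44) p.285, (153) p.301] -/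
theorem dIterL_fieldConj_apply (k : ℕ) (u : GaugeTransf P 0 (SU N)) (V₀ Y : PBond P 0 → Matrix (Fin N) (Fin N) ℂ) :
    dIterL k (fieldConj u V₀) (fieldConj u Y) = fieldConj (toMS u k) (dIterL k V₀ Y) := by
  have h := congrArg (fun L : (PBond P 0 → Matrix (Fin N) (Fin N) ℂ) →L[ℝ] (PBond P k → Matrix (Fin N) (Fin N) ℂ) => L Y) (dIterL_fieldConj_comp k u V₀)
  simpa only [ContinuousLinearMap.coe_comp, Function.comp_apply, ContinuousLinearEquiv.coe_coe, fieldConjL_apply] using h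

/-- Operator form with the inverse on the right: `Q_k(C_u V₀) = C_{u↾k} ∘ Q_k(V₀) ∘ C_{u⁻¹}`. [cite: Balaban1985Variational, (44) p.285, (153) p.301] -/
theorem dIterL_fieldConj (k : ℕ) (u : GaugeTransf P 0 (SU N)) (V₀ : PBond P 0 → Matrix (Fin N) (Fin N) ℂ) :
    dIterL k (fieldConj u V₀) =
      (fieldConjL (toMS u k) : (PBond P k → Matrix (Fin N) (Fin N) ℂ) →L[ℝ] (PBond P k → Matrix (Fin N) (Fin N) ℂ)).comp
        ((dIterL k V₀).comp ((fieldConjL u).symm : (PBond P 0 → Matrix (Fin N) (Fin N) ℂ) →L[ℝ] (PBond P 0 → Matrix (Fin N) (Fin N) ℂ))) := by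
  rw [← ContinuousLinearMap.comp_assoc, ← dIterL_fieldConj_comp, ContinuousLinearMap.comp_assoc, ContinuousLinearEquiv.coe_comp_coe_symm,
    ContinuousLinearMap.comp_id]

/-- Differentiability of the iterate is transported by the conjugation: `iterM k` is differentiable at `C_u V₀` iff at `V₀`. [cite: Balaban1987RG1, (0.21) p.256 («analytic function»)] -/
theorem differentiableAt_iterM_fieldConj_iff (k : ℕ) (u : GaugeTransf P 0 (SU N)) (V₀ : PBond P 0 → Matrix (Fin N) (Fin N) ℂ) :
    DifferentiableAt ℝ (iterM k : (PBond P 0 → Matrix (Fin N) (Fin N) ℂ) → PBond P k → Matrix (Fin N) (Fin N) ℂ) (fieldConj u V₀) ↔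
      DifferentiableAt ℝ (iterM k : (PBond P 0 → Matrix (Fin N) (Fin N) ℂ) → PBond P k → Matrix (Fin N) (Fin N) ℂ) V₀ := by
  rw [← fieldConjL_apply, ← (fieldConjL u).comp_right_differentiableAt_iff, iterM_comp_fieldConjL, (fieldConjL (toMS u k)).comp_differentiableAt_iff]

end Derivative

/-! ## §5  Print's left-trivialised reading: `qLin` covariance WITHOUT the guard and without the range hypothesis -/

section QLin

variable {P : Params} {N : ℕ} [NeZero N]

/-- The chart velocity field transforms by `C_u`: `b ↦ U^u(b)·Ad_{u(b₊)}X(b) = C_u (b ↦ U(b)·X(b))` (`u⋆u = 1` in the middle). [cite: Balaban1985Variational, (3) p.278, (153) p.301] -/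
theorem velField_gaugeAct (u : GaugeTransf P 0 (SU N)) (U : GaugeField P 0 (SU N)) (X : PBond P 0 → lieSU (Fin N)) :
    (fun b => ((GaugeField.gaugeAct u U b : SU N) : Matrix (Fin N) (Fin N) ℂ) * ((specialUnitaryAd (u b.tgt) (X b) : lieSU (Fin N)) : Matrix (Fin N) (Fin N) ℂ)) =
      fieldConj u (fun b => (U b : Matrix (Fin N) (Fin N) ℂ) * (X b : Matrix (Fin N) (Fin N) ℂ)) := by
  funext b
  show ((u b.src * U b * (u b.tgt)⁻¹ : SU N) : Matrix (Fin N) (Fin N) ℂ) *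
      ((u b.tgt : Matrix (Fin N) (Fin N) ℂ) * (X b : Matrix (Fin N) (Fin N) ℂ) * star (u b.tgt : Matrix (Fin N) (Fin N) ℂ)) =
    (u b.src : Matrix (Fin N) (Fin N) ℂ) * ((U b : Matrix (Fin N) (Fin N) ℂ) * (X b : Matrix (Fin N) (Fin N) ℂ)) * star (u b.tgt : Matrix (Fin N) (Fin N) ℂ)
  rw [Submonoid.coe_mul, Submonoid.coe_mul, coe_inv_SU]
  calc (u b.src : Matrix (Fin N) (Fin N) ℂ) * (U b : Matrix (Fin N) (Fin N) ℂ) * star (u b.tgt : Matrix (Fin N) (Fin N) ℂ) *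
        ((u b.tgt : Matrix (Fin N) (Fin N) ℂ) * (X b : Matrix (Fin N) (Fin N) ℂ) * star (u b.tgt : Matrix (Fin N) (Fin N) ℂ))
      = (u b.src : Matrix (Fin N) (Fin N) ℂ) * ((U b : Matrix (Fin N) (Fin N) ℂ) * (star (u b.tgt : Matrix (Fin N) (Fin N) ℂ) * ((u b.tgt : Matrix (Fin N) (Fin N) ℂ) *
          (X b : Matrix (Fin N) (Fin N) ℂ)))) * star (u b.tgt : Matrix (Fin N) (Fin N) ℂ) := by noncomm_ring
    _ = _ := by rw [star_coe_mul_coe_mul_SU]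

/-- ★★★ **GAUGE COVARIANCE OF `Q_k` IN THE LEFT-TRIVIALISED READING, FOR EVERY CONFIGURATION** — g0's `qLin_gaugeAct` WITHOUT `SmallBelow` and WITHOUT `k ≤ m + K`:
`(qLin k U^u (Ad_{u∘tgt}X))(c) = ū(c₊)·(qLin k U X)(c)·ū(c₊)⋆`, `ū = u↾k` — print's `Q_k(U₀^u)(R(u)X) = R(ū)(Q_k(U₀)X)`.
[cite: Balaban1985Variational, (44) p.285, (153) p.301; Balaban1985Averaging, (11) p.19; Balaban1985BackgroundPropagators, (3.29) p.395] -/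
theorem qLin_gaugeAct_of_all (k : ℕ) (u : GaugeTransf P 0 (SU N)) (U : GaugeField P 0 (SU N)) (X : PBond P 0 → lieSU (Fin N)) (c : PBond P k) :
    qLin k (GaugeField.gaugeAct u U) (fun b => specialUnitaryAd (u b.tgt) (X b)) c =
      (toMS u k c.tgt : Matrix (Fin N) (Fin N) ℂ) * qLin k U X c * star (toMS u k c.tgt : Matrix (Fin N) (Fin N) ℂ) := by
  rw [qLin_apply, qLin_apply, velField_gaugeAct, coeField_gaugeAct, dIterL_fieldConj_apply, iterM_fieldConj, fieldConj_apply, fieldConj_apply, star_mul, star_mul,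
    star_star]
  set a : Matrix (Fin N) (Fin N) ℂ := (toMS u k c.src : Matrix (Fin N) (Fin N) ℂ)
  set b : Matrix (Fin N) (Fin N) ℂ := (toMS u k c.tgt : Matrix (Fin N) (Fin N) ℂ)
  set W : Matrix (Fin N) (Fin N) ℂ := iterM k (coeField U) c
  set Y : Matrix (Fin N) (Fin N) ℂ := dIterL k (coeField U) (fun b => (U b : Matrix (Fin N) (Fin N) ℂ) * (X b : Matrix (Fin N) (Fin N) ℂ)) c
  have ha : star a * a = 1 := star_coe_mul_coe_SU _
  calc b * (star W * star a) * (a * Y * star b) = b * star W * (star a * a) * Y * star b := by noncomm_ring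
    _ = b * (star W * Y) * star b := by rw [ha]; noncomm_ring

end QLin

/-! ## §6  THE MULTI-LEVEL (0.4) WINDOW OF `Q_k(U₀)` on a downward-closed bond family -/

section Window

variable {P : Params} {N : ℕ} [NeZero N]

/-- ★★ **THE MULTI-LEVEL WINDOW OF THE LINEARISED AVERAGING**: under the guard below `k ≤ m + K`, let `S = (S_i)` be a bond family closed downward under the (0.4) window below `k`
(`c ∈ S_{i+1}`, `B(b₋) ∈ {c₋, c₊}` ⇒ `b ∈ S_i`).  Two direction fields that agree on `S_0` have the same `Q_k(↑U)`-images on `S_k` (induction on the chain rule `dIterL_succ` with the one-step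
window `dAvgL_apply_congr_of_window`). [cite: Balaban1985Averaging, p.19 («second condition»), (15) p.19; Balaban1985Variational, (44) p.285; Balaban1987RG1, (0.4) p.253, (0.21) p.256] -/
theorem dIterL_apply_congr_of_closedBelow {k : ℕ} (hk : k ≤ P.m + P.K) {U : GaugeField P 0 (SU N)}
    (h : SmallBelow (fun j => blockAvg (P := P) (j := j) expMeanLogSU) k U)
    (S : (i : ℕ) → Set (PBond P i))
    (hS : ∀ (i : ℕ) (c : PBond P (i + 1)), i + 1 ≤ k → c ∈ S (i + 1) →
      ∀ b : PBond P i, (blockOf b.src = c.src ∨ blockOf b.src = c.tgt) → b ∈ S i)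
    {Y Y' : PBond P 0 → Matrix (Fin N) (Fin N) ℂ} (hY : ∀ b ∈ S 0, Y b = Y' b) :
    ∀ i, i ≤ k → ∀ c ∈ S i, dIterL i (coeField U) Y c = dIterL i (coeField U) Y' c
  | 0, _, c, hc => by simpa only [dIterL_zero, ContinuousLinearMap.id_apply] using hY c hc
  | i + 1, hi, c, hc => by
    have hsm : SmallBelow (fun j => blockAvg (P := P) (j := j) expMeanLogSU) (i + 1) U := h.mono hi
    rw [dIterL_succ hsm, ContinuousLinearMap.comp_apply, ContinuousLinearMap.comp_apply]
    exact dAvgL_apply_congr_of_window (hi.trans hk) (loopM_iterM_mem_polydisc hsm) c fun b hb =>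
      dIterL_apply_congr_of_closedBelow hk h S hS hY i (Nat.le_of_succ_le hi) b (hS i c hi hc b hb)

/-- The same for print's left-trivialised reading: Lie-algebra fields agreeing on `S_0` have the same `qLin k U`-values on `S_k`. [cite: Balaban1985Variational, (44) p.285; Balaban1985Averaging, p.19 («second condition»)] -/
theorem qLin_congr_of_closedBelow {k : ℕ} (hk : k ≤ P.m + P.K) {U : GaugeField P 0 (SU N)}
    (h : SmallBelow (fun j => blockAvg (P := P) (j := j) expMeanLogSU) k U)
    (S : (i : ℕ) → Set (PBond P i))
    (hS : ∀ (i : ℕ) (c : PBond P (i + 1)), i + 1 ≤ k → c ∈ S (i + 1) →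
      ∀ b : PBond P i, (blockOf b.src = c.src ∨ blockOf b.src = c.tgt) → b ∈ S i)
    {X X' : PBond P 0 → lieSU (Fin N)} (hX : ∀ b ∈ S 0, X b = X' b) {c : PBond P k} (hc : c ∈ S k) :
    qLin k U X c = qLin k U X' c := by
  rw [qLin_apply, qLin_apply,
    dIterL_apply_congr_of_closedBelow hk h S hS (Y := fun b => (U b : Matrix (Fin N) (Fin N) ℂ) * (X b : Matrix (Fin N) (Fin N) ℂ))
      (Y' := fun b => (U b : Matrix (Fin N) (Fin N) ℂ) * (X' b : Matrix (Fin N) (Fin N) ℂ)) (fun b hb => by rw [hX b hb]) k le_rfl c hc]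

end Window

section WindowRecord

variable {F : T4Family} {N : ℕ} [NeZero N]

/-- At NODE 00's objects (`avOfRecord F N K j = blockAvg expMeanLogSU`, `rfl`): the multi-level window of `Q_k(↑U)` on the torus `F.P K`.
[cite: Balaban1985Variational, (44) p.285; Balaban1985Averaging, p.19 («second condition»); Balaban1988Convergent, (2.11) p.256] -/
theorem dIterL_apply_congr_of_closedBelow_avOfRecord {K k : ℕ} (hk : k ≤ (F.P K).m + (F.P K).K) {U : GaugeField (F.P K) 0 (SU N)}
    (h : SmallBelow (avOfRecord F N K) k U)
    (S : (i : ℕ) → Set (PBond (F.P K) i))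
    (hS : ∀ (i : ℕ) (c : PBond (F.P K) (i + 1)), i + 1 ≤ k → c ∈ S (i + 1) →
      ∀ b : PBond (F.P K) i, (blockOf b.src = c.src ∨ blockOf b.src = c.tgt) → b ∈ S i)
    {Y Y' : PBond (F.P K) 0 → Matrix (Fin N) (Fin N) ℂ} (hY : ∀ b ∈ S 0, Y b = Y' b) {c : PBond (F.P K) k} (hc : c ∈ S k) :
    dIterL k (coeField U) Y c = dIterL k (coeField U) Y' c :=
  dIterL_apply_congr_of_closedBelow hk h S hS hY k le_rfl c hc

end WindowRecord

end Literature.MathematicalPhysics.QuantumFieldTheory.Balaban1983to89.Node00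

end
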